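import Literature.IUT.HodgeArakelov.PowCompletionZHat
import Literature.AnabelianGeometry.AbsoluteAnabelian.AbsTopIII.KummerFaithfulLocalFieldProofs
import Mathlib.Algebra.Colimit.DirectLimit
import Mathlib.FieldTheory.Galois.Infinite
import Mathlib.FieldTheory.KrullTopology
import HarnessLib

/-!
# [IUTchII] Example 1.8 (vii) `(∗ĝp)` GENUINE: `O^ĝp(G) := lim→_J ((k̄^×)^J)^∧`, the inductive limit over open
# `J ⊆ G_k` of the profinite completions of the `J`-invariant units, with `η : k̄^× ↪ O^ĝp` INJECTIVE and its `Ẑ^×`-action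

S. Mochizuki, *Inter-universal Teichmüller theory II*, §1, Example 1.8 (vii), kurims manuscript (Dec. 2020) p. 40: the
algorithm "`(∗ĝp)`": "by considering inductive limits of profinite completions of the `J`-invariants [as `J` ranges over
the open subgroups of `G`] of the underlying … modules of `M^gp_TM(Π)`, `O^gp(G)`, we obtain … `(Π ↷ M^ĝp_TM(Π))`;
`(G ↷ O^ĝp(G))` … these algorithms `(∗^ĝp)` are compatible with a natural action of `Γ` on the underlying ind-topological
modules" [claim: Mochizuki2012, status: disputed] (IUTchII §1 Ex 1.8 (vii), kurims p.40); Remark 1.11.1 (i) (c) p. 50 (the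
kernel of `Aut(G ↷ O^ĝp(G)) → Aut(G)` "determined by the natural action of `Ẑ^×`").  abc-iut cell, layer L6, row
«GHATGP-GENUINE» (L6-lead GO 2026-08-26T10:5xZ): the GENUINE `(∗ĝp)` at abc-iut-L6-t13 / abc-iut-L6-d2's genuine producers
`AbsTopMonoids.genuineOfModel(Ism) S C ε hΔ hq` (`O^⊳(G) = 𝒪_k̄^⊳`), replacing the `(∗ĝp) := (∗gp)` READING of abc-iut-w5-d193's
`ProfiniteGroupificationsGrothendieck` (p425301: profinite completion not modelled — where abc-iut-w6-d016 showed the kernel of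
Rmk. 1.11.1 (i) (c) collapses to `{±1}`, p431190).  Seat abc-iut-L6-d2 (gen 6); STAGE 1b (post-freeze def, reading (ii)).

For the [AbsTopIII] §3 model data `C : MLFClosure` (`k` an MLF, `K = k̄`):

* `Genuine.GhatLevel C` — the LEVELS: open subgroups `J ⊆ Gal(k̄/k)` (print's "`J`-invariants"), ordered by REVERSE
  inclusion (directed: `J ∩ J'`); `Genuine.fixedUnits C J = (k̄^×)^J = (k̄^J)^×` (the groupification of the `J`-invariant
  integers `(𝒪_k̄^⊳)^J = 𝒪^⊳_{k̄^J}`); level groups `Genuine.levelGroup C i := ((k̄^×)^J)^∧` (`PowCompletion`, = the profinite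
  completion of the topological group `(k̄^J)^×`, `k̄^J/k` finite) with the transition maps `levelMap`;
* **`Genuine.Oghat C := lim→_J ((k̄^×)^J)^∧`** (Mathlib `DirectLimit`) — `O^ĝp(G)` GENUINE, a commutative group;
  `ofLevel`, `ofLevel_levelMap`;
* **`Genuine.toOghat C : k̄^× →* O^ĝp`** (`η`: every `x ∈ k̄^×` is fixed by the open subgroup `Gal(k̄/k(x))`,
  `levelOf`/`mem_fixedUnits_levelOf`; level-independence `toOghat_eq_ofLevel`) and **`toOghat_injective`**: the fixed field
  `k̄^J` of an open `J` is FINITE over `k` (Mathlib's infinite Galois correspondence `InfiniteGalois.isOpen_iff_finite`), so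
  `⋂_n ((k̄^J)^×)ⁿ = 1` by torus Kummer-faithfulness of MLFs (abc-iut-L6-t21's `MLFClosure.eq_one_of_forall_pos_exists_pow_eq`,
  [AbsTopIII] Def. 1.5 (a) / Rmk. 1.5.4 (i)) and `PowCompletion.of_injective` applies levelwise (`of_injective_level`);
* **`Genuine.zhatPowOghat C : Ẑ^× →* MulAut O^ĝp`** — "a natural action of `Γ`" (`Γ ⊆ Ẑ^×`): the levelwise `Ẑ^×`-powers
  (`PowCompletion.zhatPow`, natural in the level), assembled on the direct limit (`zhatEndOghat`, `DirectLimit.lift`).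

Sequel `AbsTopMonoidsGenuineGhatTransport.lean`: transports along equivariant automorphisms of `k̄^×`, the `G_k`-action.
HONEST FRAMING: classical algebra / infinite Galois theory / Kummer-faithfulness of MLFs over OUR typed objects (all inputs
PROVED in the tree); record-anchored to a disputed corpus only through the locators; nothing here bears on [IUTchIII]
Cor. 3.12; typed ≠ proved elsewhere; ind-TOPOLOGIES are not modelled (interface convention of `ProfiniteGroupifications`).
-/

noncomputable section

namespace Literature.IUT.HodgeArakelov

open CategoryTheory
open Literature.AnabelianGeometry.AbsoluteAnabelian

namespace AbsTopMonoids.Genuine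

variable (C : MLFClosure.{0})

/-- LEVELS of the ind-object `O^ĝp`: open subgroups `J ⊆ G_k = Gal(k̄/k)`, ordered by REVERSE inclusion (`i ≤ j` iff
`J_j ⊆ J_i`, so that the `J`-invariants grow along `≤`). [claim: Mochizuki2012, status: disputed] (IUTchII §1 Ex 1.8 (vii), kurims p.40) -/
structure GhatLevel : Type where
  /-- the open subgroup `J ⊆ Gal(k̄/k)` [claim: Mochizuki2012, status: disputed] (IUTchII §1 Ex 1.8 (vii), kurims p.40) -/
  J : OpenSubgroup (C.K ≃ₐ[C.k] C.K)

namespace GhatLevel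

/-- `instance` (structure lemma of the genuine `(∗ĝp)` construction). [claim: Mochizuki2012, status: disputed] (IUTchII §1 Ex 1.8 (vii), kurims p.40) -/
instance : Preorder (GhatLevel C) where
  le i j := (j.J : Subgroup (C.K ≃ₐ[C.k] C.K)) ≤ i.J
  le_refl _ := le_rfl
  le_trans _ _ _ h₁ h₂ := le_trans (α := Subgroup (C.K ≃ₐ[C.k] C.K)) h₂ h₁

/-- `le_iff` (structure lemma of the genuine `(∗ĝp)` construction). [claim: Mochizuki2012, status: disputed] (IUTchII §1 Ex 1.8 (vii), kurims p.40) -/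
theorem le_iff {i j : GhatLevel C} : i ≤ j ↔ (j.J : Subgroup (C.K ≃ₐ[C.k] C.K)) ≤ i.J := Iff.rfl

/-- `instance` (structure lemma of the genuine `(∗ĝp)` construction). [claim: Mochizuki2012, status: disputed] (IUTchII §1 Ex 1.8 (vii), kurims p.40) -/
instance : IsDirectedOrder (GhatLevel C) :=
  ⟨fun i j => ⟨⟨i.J ⊓ j.J⟩,
    fun _ hσ => (OpenSubgroup.mem_inf.mp hσ).1,
    fun _ hσ => (OpenSubgroup.mem_inf.mp hσ).2⟩⟩

/-- `instance` (structure lemma of the genuine `(∗ĝp)` construction). [claim: Mochizuki2012, status: disputed] (IUTchII §1 Ex 1.8 (vii), kurims p.40) -/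
instance : Nonempty (GhatLevel C) := ⟨⟨⊤⟩⟩

end GhatLevel

/-- The `J`-INVARIANT units `(k̄^×)^J = (k̄^J)^×` (`J ⊆ Gal(k̄/k)`), as a subgroup of `k̄^×` — the groupification
`((𝒪_k̄^⊳)^J)^gp` of the `J`-invariants of `O^⊳(G) = 𝒪_k̄^⊳` (every element of `k̄^J` is a quotient of `J`-invariant
integers). [claim: Mochizuki2012, status: disputed] (IUTchII §1 Ex 1.8 (vii), kurims p.40) -/
def fixedUnits (J : Subgroup (C.K ≃ₐ[C.k] C.K)) : Subgroup (C.K)ˣ where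
  carrier := {x | ∀ σ ∈ J, σ (x : C.K) = x}
  one_mem' := fun σ _ => by simp
  mul_mem' := fun {x y} hx hy σ hσ => by rw [Units.val_mul, map_mul, hx σ hσ, hy σ hσ]
  inv_mem' := fun {x} hx σ hσ => by rw [Units.val_inv_eq_inv_val, map_inv₀, hx σ hσ]

/-- `mem_fixedUnits_iff` (structure lemma of the genuine `(∗ĝp)` construction). [claim: Mochizuki2012, status: disputed] (IUTchII §1 Ex 1.8 (vii), kurims p.40) -/
theorem mem_fixedUnits_iff {J : Subgroup (C.K ≃ₐ[C.k] C.K)} {x : (C.K)ˣ} :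
    x ∈ fixedUnits C J ↔ ∀ σ ∈ J, σ (x : C.K) = x := Iff.rfl

/-- `fixedUnits_mono` (structure lemma of the genuine `(∗ĝp)` construction). [claim: Mochizuki2012, status: disputed] (IUTchII §1 Ex 1.8 (vii), kurims p.40) -/
theorem fixedUnits_mono {J J' : Subgroup (C.K ≃ₐ[C.k] C.K)} (h : J' ≤ J) : fixedUnits C J ≤ fixedUnits C J' :=
  fun _ hx σ hσ => hx σ (h hσ)

/-- The level groups `((k̄^×)^J)^∧` (power = profinite completion of `(k̄^J)^×`).
[claim: Mochizuki2012, status: disputed] (IUTchII §1 Ex 1.8 (vii), kurims p.40) -/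
abbrev levelGroup (i : GhatLevel C) : Type := PowCompletion (fixedUnits C (i.J : Subgroup (C.K ≃ₐ[C.k] C.K)))

/-- Transition maps `((k̄^×)^{J_i})^∧ → ((k̄^×)^{J_j})^∧` for `J_j ⊆ J_i`.
[claim: Mochizuki2012, status: disputed] (IUTchII §1 Ex 1.8 (vii), kurims p.40) -/
def levelMap (i j : GhatLevel C) (h : i ≤ j) : levelGroup C i →* levelGroup C j :=
  PowCompletion.map (Subgroup.inclusion (fixedUnits_mono C h))

/-- `levelMap_of` (structure lemma of the genuine `(∗ĝp)` construction). [claim: Mochizuki2012, status: disputed] (IUTchII §1 Ex 1.8 (vii), kurims p.40) -/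
theorem levelMap_of (i j : GhatLevel C) (h : i ≤ j) (x : fixedUnits C (i.J : Subgroup (C.K ≃ₐ[C.k] C.K))) :
    levelMap C i j h (PowCompletion.of _ x) = PowCompletion.of _ (Subgroup.inclusion (fixedUnits_mono C h) x) :=
  PowCompletion.map_of _ _

/-- `instance` (structure lemma of the genuine `(∗ĝp)` construction). [claim: Mochizuki2012, status: disputed] (IUTchII §1 Ex 1.8 (vii), kurims p.40) -/
instance : DirectedSystem (levelGroup C) (fun i j h => levelMap C i j h) where
  map_self i x := by
    have h : levelMap C i i le_rfl = MonoidHom.id _ := by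
      rw [← PowCompletion.map_id]
      exact PowCompletion.map_congr (fun a => Subtype.ext rfl)
    rw [h, MonoidHom.id_apply]
  map_map {k j i} hij hjk x := by
    have h : (levelMap C j k hjk).comp (levelMap C i j hij) = levelMap C i k (hij.trans hjk) := by
      change (PowCompletion.map _).comp (PowCompletion.map _) = PowCompletion.map _
      rw [← PowCompletion.map_comp]
      exact PowCompletion.map_congr (fun a => Subtype.ext rfl)
    rw [← MonoidHom.comp_apply, h]

/-- **`O^ĝp(G)` GENUINE**: the inductive limit over open `J ⊆ G_k` of the (power = profinite) completions of the
`J`-invariant units `((k̄^×)^J)^∧` — "(∗ĝp) … inductive limits of profinite completions of the `J`-invariants".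
[claim: Mochizuki2012, status: disputed] (IUTchII §1 Ex 1.8 (vii), kurims p.40) -/
abbrev Oghat : Type := DirectLimit (levelGroup C) (levelMap C)

/-- The structure map of the level `J` into `O^ĝp`. [claim: Mochizuki2012, status: disputed] (IUTchII §1 Ex 1.8 (vii), kurims p.40) -/
def ofLevel (i : GhatLevel C) : levelGroup C i →* Oghat C where
  toFun x := (⟦⟨i, x⟩⟧ : DirectLimit (levelGroup C) (levelMap C))
  map_one' := (DirectLimit.one_def (G := levelGroup C) (f := levelMap C) i).symm
  map_mul' x y := (DirectLimit.mul_def (G := levelGroup C) (f := levelMap C) i x y).symm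

/-- `ofLevel_apply` (structure lemma of the genuine `(∗ĝp)` construction). [claim: Mochizuki2012, status: disputed] (IUTchII §1 Ex 1.8 (vii), kurims p.40) -/
theorem ofLevel_apply (i : GhatLevel C) (x : levelGroup C i) :
    ofLevel C i x = (⟦⟨i, x⟩⟧ : DirectLimit (levelGroup C) (levelMap C)) := rfl

/-- `ofLevel_levelMap` (structure lemma of the genuine `(∗ĝp)` construction). [claim: Mochizuki2012, status: disputed] (IUTchII §1 Ex 1.8 (vii), kurims p.40) -/
@[simp] theorem ofLevel_levelMap {i j : GhatLevel C} (h : i ≤ j) (x : levelGroup C i) :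
    ofLevel C j (levelMap C i j h x) = ofLevel C i x :=
  DirectLimit.mk_apply (f := levelMap C) i j x h

/-! ## `k̄^× → O^ĝp`: every unit is invariant under an open subgroup -/

/-- The open subgroup `Gal(k̄/k(x))` fixing `x ∈ k̄^×`, as a level. [claim: Mochizuki2012, status: disputed] (IUTchII §1 Ex 1.8 (vii), kurims p.40) -/
def levelOf (x : (C.K)ˣ) : GhatLevel C :=
  haveI : FiniteDimensional C.k (IntermediateField.adjoin C.k {(x : C.K)}) :=
    IntermediateField.adjoin.finiteDimensional
      ((Algebra.IsAlgebraic.isAlgebraic (R := C.k) (x : C.K)).isIntegral)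
  ⟨⟨(IntermediateField.adjoin C.k {(x : C.K)}).fixingSubgroup,
    IntermediateField.fixingSubgroup_isOpen (IntermediateField.adjoin C.k {(x : C.K)})⟩⟩

/-- `mem_fixedUnits_levelOf` (structure lemma of the genuine `(∗ĝp)` construction). [claim: Mochizuki2012, status: disputed] (IUTchII §1 Ex 1.8 (vii), kurims p.40) -/
theorem mem_fixedUnits_levelOf (x : (C.K)ˣ) :
    x ∈ fixedUnits C ((levelOf C x).J : Subgroup (C.K ≃ₐ[C.k] C.K)) := by
  intro σ hσ
  exact (IntermediateField.mem_fixingSubgroup_iff _ _).mp hσ _ (IntermediateField.mem_adjoin_simple_self C.k (x : C.K))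

/-- `η(x)` computed at any level containing `x`. [claim: Mochizuki2012, status: disputed] (IUTchII §1 Ex 1.8 (vii), kurims p.40) -/
theorem ofLevel_of_eq_ofLevel_of {i j : GhatLevel C} (x : (C.K)ˣ)
    (hi : x ∈ fixedUnits C (i.J : Subgroup (C.K ≃ₐ[C.k] C.K))) (hj : x ∈ fixedUnits C (j.J : Subgroup (C.K ≃ₐ[C.k] C.K))) :
    ofLevel C i (PowCompletion.of _ ⟨x, hi⟩) = ofLevel C j (PowCompletion.of _ ⟨x, hj⟩) := by
  obtain ⟨l, hil, hjl⟩ := exists_ge_ge i j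
  rw [← ofLevel_levelMap C hil, ← ofLevel_levelMap C hjl, levelMap_of, levelMap_of]
  rfl

/-- **`η : k̄^× → O^ĝp(G)`** (the groupification `O^gp(G) = k̄^×` mapping to the ind-completion): `x ↦ [η_J(x)]` for
any open `J` fixing `x`. [claim: Mochizuki2012, status: disputed] (IUTchII §1 Ex 1.8 (vii), kurims p.40) -/
def toOghat : (C.K)ˣ →* Oghat C where
  toFun x := ofLevel C (levelOf C x) (PowCompletion.of _ ⟨x, mem_fixedUnits_levelOf C x⟩)
  map_one' := by
    have h1 : (1 : (C.K)ˣ) ∈ fixedUnits C ((levelOf C 1).J : Subgroup (C.K ≃ₐ[C.k] C.K)) := Subgroup.one_mem _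
    change ofLevel C (levelOf C 1) (PowCompletion.of _ ⟨1, h1⟩) = 1
    have : (⟨1, h1⟩ : fixedUnits C ((levelOf C 1).J : Subgroup (C.K ≃ₐ[C.k] C.K))) = 1 := rfl
    rw [this, map_one, map_one]
  map_mul' x y := by
    obtain ⟨l, hxl, hyl⟩ := exists_ge_ge (levelOf C x) (levelOf C y)
    obtain ⟨m, hlm, hxym⟩ := exists_ge_ge l (levelOf C (x * y))
    have hx : x ∈ fixedUnits C (m.J : Subgroup (C.K ≃ₐ[C.k] C.K)) :=
      fixedUnits_mono C (hxl.trans hlm) (mem_fixedUnits_levelOf C x)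
    have hy : y ∈ fixedUnits C (m.J : Subgroup (C.K ≃ₐ[C.k] C.K)) :=
      fixedUnits_mono C (hyl.trans hlm) (mem_fixedUnits_levelOf C y)
    have hxy : x * y ∈ fixedUnits C (m.J : Subgroup (C.K ≃ₐ[C.k] C.K)) := Subgroup.mul_mem _ hx hy
    change ofLevel C (levelOf C (x * y)) (PowCompletion.of _ ⟨x * y, mem_fixedUnits_levelOf C (x * y)⟩) =
      ofLevel C (levelOf C x) (PowCompletion.of _ ⟨x, mem_fixedUnits_levelOf C x⟩) *
        ofLevel C (levelOf C y) (PowCompletion.of _ ⟨y, mem_fixedUnits_levelOf C y⟩)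
    rw [ofLevel_of_eq_ofLevel_of C (x * y) (mem_fixedUnits_levelOf C (x * y)) hxy,
      ofLevel_of_eq_ofLevel_of C x (mem_fixedUnits_levelOf C x) hx,
      ofLevel_of_eq_ofLevel_of C y (mem_fixedUnits_levelOf C y) hy, ← map_mul, ← map_mul]
    rfl

/-- `toOghat_eq_ofLevel` (structure lemma of the genuine `(∗ĝp)` construction). [claim: Mochizuki2012, status: disputed] (IUTchII §1 Ex 1.8 (vii), kurims p.40) -/
theorem toOghat_eq_ofLevel (x : (C.K)ˣ) (i : GhatLevel C) (hi : x ∈ fixedUnits C (i.J : Subgroup (C.K ≃ₐ[C.k] C.K))) :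
    toOghat C x = ofLevel C i (PowCompletion.of _ ⟨x, hi⟩) :=
  ofLevel_of_eq_ofLevel_of C x _ hi

/-! ## Injectivity of `η` on `k̄^×`: torus Kummer-faithfulness of the finite levels -/

/-- The fixed field of an open subgroup of `Gal(k̄/k)` is finite over `k` (infinite Galois theory). [claim: Mochizuki2012, status: disputed] (IUTchII §1 Ex 1.8 (vii), kurims p.40) -/
theorem finiteDimensional_fixedField (J : OpenSubgroup (C.K ≃ₐ[C.k] C.K)) :
    FiniteDimensional C.k (IntermediateField.fixedField (J : Subgroup (C.K ≃ₐ[C.k] C.K))) := by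
  haveI : IsGalois C.k C.K := {}
  set L : IntermediateField C.k C.K := IntermediateField.fixedField (J : Subgroup (C.K ≃ₐ[C.k] C.K))
  have hJc : IsClosed ((J : Subgroup (C.K ≃ₐ[C.k] C.K)) : Set (C.K ≃ₐ[C.k] C.K)) :=
    Subgroup.isClosed_of_isOpen _ J.isOpen
  let Jc : ClosedSubgroup (C.K ≃ₐ[C.k] C.K) := ⟨(J : Subgroup (C.K ≃ₐ[C.k] C.K)), hJc⟩
  have hfix : L.fixingSubgroup = (J : Subgroup (C.K ≃ₐ[C.k] C.K)) :=
    InfiniteGalois.fixingSubgroup_fixedField Jc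
  refine (InfiniteGalois.isOpen_iff_finite L).mp ?_
  change IsOpen (L.fixingSubgroup : Set (C.K ≃ₐ[C.k] C.K))
  rw [hfix]
  exact J.isOpen

/-- `η_J : (k̄^×)^J → ((k̄^×)^J)^∧` is injective: `⋂_n ((k̄^J)^×)ⁿ = 1` since `k̄^J` is a finite extension of the MLF `k`
([AbsTopIII] Def. 1.5 (a) / Rmk. 1.5.4 (i), the tree's `MLFClosure.eq_one_of_forall_pos_exists_pow_eq`).
[claim: Mochizuki2012, status: disputed] (IUTchII §1 Ex 1.8 (vii), kurims p.40) -/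
theorem of_injective_level (i : GhatLevel C) :
    Function.Injective (PowCompletion.of (fixedUnits C (i.J : Subgroup (C.K ≃ₐ[C.k] C.K)))) := by
  haveI := finiteDimensional_fixedField C i.J
  refine PowCompletion.of_injective ⟨fun x hx => ?_⟩
  apply Subtype.ext
  apply Units.ext
  have hxL : ((x : (C.K)ˣ) : C.K) ∈ IntermediateField.fixedField (i.J : Subgroup (C.K ≃ₐ[C.k] C.K)) :=
    (IntermediateField.mem_fixedField_iff _ _).mpr x.2
  refine C.eq_one_of_forall_pos_exists_pow_eq (IntermediateField.fixedField (i.J : Subgroup (C.K ≃ₐ[C.k] C.K)))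
    hxL (x : (C.K)ˣ).ne_zero fun n hn => ?_
  obtain ⟨y, hy⟩ := hx n hn
  refine ⟨((y : (C.K)ˣ) : C.K), (IntermediateField.mem_fixedField_iff _ _).mpr y.2, ?_⟩
  have := congrArg (fun z : fixedUnits C (i.J : Subgroup (C.K ≃ₐ[C.k] C.K)) => ((z : (C.K)ˣ) : C.K)) hy
  simpa using this

/-- **`η : k̄^× → O^ĝp(G)` is injective.** [claim: Mochizuki2012, status: disputed] (IUTchII §1 Ex 1.8 (vii), kurims p.40) -/
theorem toOghat_injective : Function.Injective (toOghat C) := by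
  intro x y hxy
  have h1 : toOghat C (x * y⁻¹) = 1 := by rw [map_mul, map_inv, hxy, mul_inv_cancel]
  suffices x * y⁻¹ = 1 by rwa [mul_inv_eq_one] at this
  set z := x * y⁻¹ with hz
  rw [toOghat_eq_ofLevel C z (levelOf C z) (mem_fixedUnits_levelOf C z), ofLevel_apply] at h1
  obtain ⟨j, hj, hmap⟩ := (DirectLimit.exists_eq_one (G := levelGroup C) (f := levelMap C) _).mp h1
  change levelMap C _ j hj (PowCompletion.of _ _) = 1 at hmap
  rw [levelMap_of] at hmap
  have := of_injective_level C j (hmap.trans (map_one _).symm)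
  simpa using congrArg (fun w : fixedUnits C (j.J : Subgroup (C.K ≃ₐ[C.k] C.K)) => (w : (C.K)ˣ)) this


/-! ## The natural `Ẑ^×`-action on `O^ĝp` (levelwise `x ↦ x^u`) -/

/-- Level `J` composed with the `u`-th power, as a map into `O^ĝp`. [claim: Mochizuki2012, status: disputed] (IUTchII §1 Ex 1.8 (vii), kurims p.40) -/
def zhatLevelHom (u : ZHatUnits) (i : GhatLevel C) : levelGroup C i →* Oghat C :=
  (ofLevel C i).comp (PowCompletion.zhatPow _ u).toMonoidHom

/-- `zhatLevelHom_compat` (structure lemma of the genuine `(∗ĝp)` construction). [claim: Mochizuki2012, status: disputed] (IUTchII §1 Ex 1.8 (vii), kurims p.40) -/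
theorem zhatLevelHom_compat (u : ZHatUnits) (i j : GhatLevel C) (h : i ≤ j) (x : levelGroup C i) :
    zhatLevelHom C u i x = zhatLevelHom C u j (levelMap C i j h x) := by
  change ofLevel C i (PowCompletion.zhatPow _ u x) = ofLevel C j (PowCompletion.zhatPow _ u (PowCompletion.map _ x))
  rw [← PowCompletion.map_zhatPow]
  exact (ofLevel_levelMap C h _).symm

/-- The `u`-th power endomorphism of `O^ĝp`, `u ∈ Ẑ^×`. [claim: Mochizuki2012, status: disputed] (IUTchII §1 Ex 1.8 (vii), kurims p.40) -/
def zhatEndOghat (u : ZHatUnits) : Oghat C →* Oghat C where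
  toFun := DirectLimit.lift (levelMap C) (fun i => ⇑(zhatLevelHom C u i)) (zhatLevelHom_compat C u)
  map_one' := DirectLimit.lift_one (f := levelMap C) (zhatLevelHom C u ·) (zhatLevelHom_compat C u)
  map_mul' := DirectLimit.lift_mul (f := levelMap C) (zhatLevelHom C u ·) (zhatLevelHom_compat C u)

/-- `zhatEndOghat_ofLevel` (structure lemma of the genuine `(∗ĝp)` construction). [claim: Mochizuki2012, status: disputed] (IUTchII §1 Ex 1.8 (vii), kurims p.40) -/
theorem zhatEndOghat_ofLevel (u : ZHatUnits) (i : GhatLevel C) (x : levelGroup C i) :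
    zhatEndOghat C u (ofLevel C i x) = ofLevel C i (PowCompletion.zhatPow _ u x) := rfl

/-- `zhatEndOghat_one` (structure lemma of the genuine `(∗ĝp)` construction). [claim: Mochizuki2012, status: disputed] (IUTchII §1 Ex 1.8 (vii), kurims p.40) -/
theorem zhatEndOghat_one : zhatEndOghat C 1 = MonoidHom.id _ := by
  ext z
  induction z using DirectLimit.induction with
  | ih i x =>
    change zhatEndOghat C 1 (ofLevel C i x) = ofLevel C i x
    rw [zhatEndOghat_ofLevel, map_one, MulAut.one_apply]

/-- `zhatEndOghat_mul` (structure lemma of the genuine `(∗ĝp)` construction). [claim: Mochizuki2012, status: disputed] (IUTchII §1 Ex 1.8 (vii), kurims p.40) -/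
theorem zhatEndOghat_mul (u v : ZHatUnits) : zhatEndOghat C (u * v) = (zhatEndOghat C u).comp (zhatEndOghat C v) := by
  ext z
  induction z using DirectLimit.induction with
  | ih i x =>
    change zhatEndOghat C (u * v) (ofLevel C i x) = zhatEndOghat C u (zhatEndOghat C v (ofLevel C i x))
    rw [zhatEndOghat_ofLevel, zhatEndOghat_ofLevel, zhatEndOghat_ofLevel, map_mul, MulAut.mul_apply]

/-- **"a natural action of `Γ` on the underlying ind-topological module of `O^ĝp(G)`"** for `Γ = Ẑ^×`: the homomorphism
`Ẑ^× → Aut(O^ĝp)`, `u ↦ (x ↦ x^u)` levelwise. [claim: Mochizuki2012, status: disputed] (IUTchII §1 Ex 1.8 (vii), kurims p.40) -/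
def zhatPowOghat : ZHatUnits →* MulAut (Oghat C) where
  toFun u :=
    { toFun := zhatEndOghat C u
      invFun := zhatEndOghat C u⁻¹
      left_inv := fun x => by
        rw [← MonoidHom.comp_apply, ← zhatEndOghat_mul, inv_mul_cancel, zhatEndOghat_one, MonoidHom.id_apply]
      right_inv := fun x => by
        rw [← MonoidHom.comp_apply, ← zhatEndOghat_mul, mul_inv_cancel, zhatEndOghat_one, MonoidHom.id_apply]
      map_mul' := map_mul (zhatEndOghat C u) }
  map_one' := MulEquiv.ext fun x => by
    change zhatEndOghat C 1 x = x
    rw [zhatEndOghat_one, MonoidHom.id_apply]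
  map_mul' u v := MulEquiv.ext fun x => by
    change zhatEndOghat C (u * v) x = zhatEndOghat C u (zhatEndOghat C v x)
    rw [zhatEndOghat_mul, MonoidHom.comp_apply]

/-- `zhatPowOghat_ofLevel` (structure lemma of the genuine `(∗ĝp)` construction). [claim: Mochizuki2012, status: disputed] (IUTchII §1 Ex 1.8 (vii), kurims p.40) -/
@[simp] theorem zhatPowOghat_ofLevel (u : ZHatUnits) (i : GhatLevel C) (x : levelGroup C i) :
    zhatPowOghat C u (ofLevel C i x) = ofLevel C i (PowCompletion.zhatPow _ u x) := rfl

end AbsTopMonoids.Genuine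

end Literature.IUT.HodgeArakelov

end
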